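import Literature.Analysis.FunctionSpaces.TorusLerayHelmholtzH1
import Literature.Analysis.FluidPDE.PassiveScalarMaximumPrinciple
import HarnessLib

/-!
# The transport–diffusion equation satisfied by the derivatives of a classical passive scalar

For a classical solution `θ` of `∂ₜθ + u·∇θ = κΔθ` on `[a, b] × T^d` (`Torus.IsClassicalScalarTransportOn`), each
spatial derivative `g = ∂ᵢθ` is jointly smooth and solves the SAME equation with a source term,
`∂ₜ(∂ᵢθ) + u·∇(∂ᵢθ) = κΔ(∂ᵢθ) − ⟪∂ᵢu, ∇θ⟫`
(differentiate the equation; mixed partials commute: `∂ᵢ∂ₜ = ∂ₜ∂ᵢ` one-sided on `[a, b]`, `∂ᵢ∇ = ∇∂ᵢ`,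
`∂ᵢΔ = Δ∂ᵢ` — Evans 2010, §7.1.3, proof of Thm. 5 (improved regularity: "differentiate the PDE with respect to
`x_k`"), here for smooth solutions where it is literal).  Combined with the maximum principle with a source term
(`Torus.abs_le_add_integral_of_source`, `PassiveScalarMaximumPrinciple`) this gives the sup-norm envelope
`|∂ᵢθ(t, x)| ≤ sup|∂ᵢθ(a, ·)| + ∫ₐᵗ F` for any continuous bound `|⟪∂ᵢu, ∇θ⟫(s, ·)| ≤ F(s)`; for a SHEAR drift
`u = (r(t)U(x₂), 0, …)` one has `∂₁u = 0` (so `sup|∂₁θ|` does not increase) and `⟪∂₂u, ∇θ⟫ = r U′ ∂₁θ`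
(so `sup|∂₂θ(t)| ≤ sup|∂₂θ(a)| + sup|U′|·sup|∂₁θ(a)|·∫ₐᵗ|r|`) — the per-pulse gradient envelope of the cell
`ad-ideate` (seat ad-p2, K3′ line v2, `ShearGradientEnvelope`).  Theorems only; no definitions, no facts.  (Coordinates of the gradient: `Torus.gradient_apply_eq_partialDeriv`
in `NSHopfLimit`.)

## References
* L. C. Evans, *Partial Differential Equations*, 2nd ed. (2010), §7.1.3 Thm. 5 (proof: differentiate the equation in
  `x_k`), §7.1.4 Thms. 8–9. [Evans2010]
-/

open MeasureTheory Set Filter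
open _root_.Topology
open scoped InnerProductSpace ContDiff

noncomputable section

namespace Literature.Analysis.FluidPDE

namespace Torus

variable {d : Type*} [Fintype d] [DecidableEq d]

namespace IsClassicalScalarTransportOn

variable {κ : ℝ} {u : ℝ → UnitAddTorus d → EuclideanSpace ℝ d} {θ : ℝ → UnitAddTorus d → ℝ}

/-- **The equation for `∂ᵢθ`.** If `θ` solves `∂ₜθ + u·∇θ = κΔθ` classically on `[a, b] × T^d` (`a < b`), then for
every `t ∈ [a, b]`, `x ∈ T^d` and direction `i`,
`∂ₜ(∂ᵢθ)(t, x) + ⟪u, ∇(∂ᵢθ)⟫(t, x) = κ Δ(∂ᵢθ)(t, x) − ⟪∂ᵢu(t, x), ∇θ(t, x)⟫`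
(one-sided time derivative within `[a, b]`, as in the structure). [cite: Evans2010, §7.1.3 Thm. 5 (proof: differentiate the equation with respect to x_k)] -/
theorem partialDeriv_transport {a b : ℝ} (hab : a < b) (h : IsClassicalScalarTransportOn (Icc a b) κ u θ)
    (i : d) {t : ℝ} (ht : t ∈ Icc a b) (x : UnitAddTorus d) :
    FunctionSpaces.Torus.timeDerivWithin (Icc a b) (fun s => FunctionSpaces.Torus.partialDeriv i (θ s)) t x +
        ⟪u t x, FunctionSpaces.Torus.gradient (FunctionSpaces.Torus.partialDeriv i (θ t)) x⟫_ℝ =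
      κ * FunctionSpaces.Torus.laplacian (FunctionSpaces.Torus.partialDeriv i (θ t)) x +
        -⟪FunctionSpaces.Torus.partialDeriv i (u t) x, FunctionSpaces.Torus.gradient (θ t) x⟫_ℝ := by
  have hU : UniqueDiffOn ℝ (Icc a b) := uniqueDiffOn_Icc hab
  have hθs := h.smooth_scalar
  have hθt : FunctionSpaces.Torus.IsSmooth (θ t) := hθs.isSmooth_slice ht
  have hut : FunctionSpaces.Torus.IsSmooth (u t) := h.smooth_velocity.isSmooth_slice ht
  have hA : FunctionSpaces.Torus.IsSmooth (FunctionSpaces.Torus.timeDerivWithin (Icc a b) θ t) :=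
    hθs.isSmooth_timeDerivWithin hU ht
  -- the equation at time `t` as an identity of functions of `x`
  have heq : (FunctionSpaces.Torus.timeDerivWithin (Icc a b) θ t +
      fun y => ⟪u t y, FunctionSpaces.Torus.gradient (θ t) y⟫_ℝ) =
      κ • FunctionSpaces.Torus.laplacian (θ t) := by
    funext y
    simpa [Pi.add_apply, Pi.smul_apply, smul_eq_mul] using h.transport t ht y
  have hcongr : FunctionSpaces.Torus.partialDeriv i (FunctionSpaces.Torus.timeDerivWithin (Icc a b) θ t +
      fun y => ⟪u t y, FunctionSpaces.Torus.gradient (θ t) y⟫_ℝ) x =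
      FunctionSpaces.Torus.partialDeriv i (κ • FunctionSpaces.Torus.laplacian (θ t)) x := by rw [heq]
  rw [FunctionSpaces.Torus.partialDeriv_add (hA.isContDiff (by simp))
      ((hut.inner hθt.gradient).isContDiff (by simp)), Pi.add_apply,
    FunctionSpaces.Torus.partialDeriv_inner (hut.isContDiff (by simp)) (hθt.gradient.isContDiff (by simp)),
    FunctionSpaces.Torus.partialDeriv_gradient_comm hθt,
    FunctionSpaces.Torus.partialDeriv_const_smul (hθt.laplacian.isContDiff (by simp)), Pi.smul_apply,
    FunctionSpaces.Torus.partialDeriv_laplacian_comm hθt, smul_eq_mul,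
    ← FunctionSpaces.Torus.timeDerivWithin_partialDeriv_comm hab hθs ht i x] at hcongr
  linarith

/-- The derivative `∂ᵢθ` of a classical solution is jointly smooth on `[a, b] × T^d`. [cite: Evans2010, §7.1.3 Thm. 5–7 (smoothness of solutions)] -/
theorem isSmoothSpaceTimeOn_partialDeriv {a b : ℝ} (hab : a < b)
    (h : IsClassicalScalarTransportOn (Icc a b) κ u θ) (i : d) :
    FunctionSpaces.Torus.IsSmoothSpaceTimeOn (Icc a b) (fun s => FunctionSpaces.Torus.partialDeriv i (θ s)) :=
  h.smooth_scalar.partialDeriv (uniqueDiffOn_Icc hab) i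


/-- **Sup-norm envelope of `∂ᵢθ`.** For a classical solution on `S ⊇ [a, b]` (`κ ≥ 0`) with `|∂ᵢθ(a, ·)| ≤ M` and a
continuous bound `|⟪∂ᵢu(s, x), ∇θ(s, x)⟫| ≤ F(s)` on `[a, b]`: `|∂ᵢθ(t, x)| ≤ M + ∫ₐᵗ F` for `t ∈ [a, b]` (the
equation for `∂ᵢθ`, `partialDeriv_transport`, and the maximum principle with source,
`Torus.abs_le_add_integral_of_source`). [cite: Evans2010, §7.1.4 Thms. 8–9 (weak maximum principle) with §7.1.3 Thm. 5 (differentiated equation)] -/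
theorem abs_partialDeriv_le_add_integral {S : Set ℝ} (h : IsClassicalScalarTransportOn S κ u θ) (hκ : 0 ≤ κ)
    {a b : ℝ} (hI : Icc a b ⊆ S) (i : d) {M : ℝ}
    (hM : ∀ x, |FunctionSpaces.Torus.partialDeriv i (θ a) x| ≤ M) {F : ℝ → ℝ}
    (hF : ∀ t ∈ Icc a b, ∀ x, |⟪FunctionSpaces.Torus.partialDeriv i (u t) x,
      FunctionSpaces.Torus.gradient (θ t) x⟫_ℝ| ≤ F t)
    (hFc : ContinuousOn F (Icc a b)) {t : ℝ} (ht : t ∈ Icc a b) (x : UnitAddTorus d) :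
    |FunctionSpaces.Torus.partialDeriv i (θ t) x| ≤ M + ∫ s in a..t, F s := by
  rcases eq_or_lt_of_le ht.1 with rfl | hat
  · simpa using hM x
  have hab : a < b := hat.trans_le ht.2
  have h' := h.restrict_Icc hab hI
  have hg := h'.isSmoothSpaceTimeOn_partialDeriv hab i
  have heq : ∀ s ∈ Icc a b, ∀ y,
      FunctionSpaces.Torus.timeDerivWithin (Icc a b) (fun s => FunctionSpaces.Torus.partialDeriv i (θ s)) s y +
        ⟪u s y, FunctionSpaces.Torus.gradient (FunctionSpaces.Torus.partialDeriv i (θ s)) y⟫_ℝ =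
      κ * FunctionSpaces.Torus.laplacian (FunctionSpaces.Torus.partialDeriv i (θ s)) y +
        -⟪FunctionSpaces.Torus.partialDeriv i (u s) y, FunctionSpaces.Torus.gradient (θ s) y⟫_ℝ :=
    fun s hs y => h'.partialDeriv_transport hab i hs y
  exact abs_le_add_integral_of_source (f := fun s y =>
      -⟪FunctionSpaces.Torus.partialDeriv i (u s) y, FunctionSpaces.Torus.gradient (θ s) y⟫_ℝ)
    hg heq hκ subset_rfl hM (fun s hs y => by simpa [abs_neg] using hF s hs y) hFc ht x

/-- **A drift independent of `xᵢ` does not increase `sup|∂ᵢθ|`.** If `∂ᵢu ≡ 0` on `[a, b]` (e.g. the streamwise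
derivative of a shear flow) and `|∂ᵢθ(a, ·)| ≤ M`, then `|∂ᵢθ(t, ·)| ≤ M` on `[a, b]` (`∂ᵢθ` solves the
source-free equation). [cite: Evans2010, §7.1.4 Thm. 8 (weak maximum principle, applied to the differentiated equation)] -/
theorem abs_partialDeriv_le_of_partialDeriv_velocity_eq_zero {S : Set ℝ} (h : IsClassicalScalarTransportOn S κ u θ)
    (hκ : 0 ≤ κ) {a b : ℝ} (hI : Icc a b ⊆ S) (i : d) {M : ℝ}
    (hM : ∀ x, |FunctionSpaces.Torus.partialDeriv i (θ a) x| ≤ M)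
    (hu : ∀ t ∈ Icc a b, ∀ x, FunctionSpaces.Torus.partialDeriv i (u t) x = 0)
    {t : ℝ} (ht : t ∈ Icc a b) (x : UnitAddTorus d) :
    |FunctionSpaces.Torus.partialDeriv i (θ t) x| ≤ M := by
  have h0 := h.abs_partialDeriv_le_add_integral hκ hI i hM (F := fun _ => 0)
    (fun s hs y => by rw [hu s hs y, inner_zero_left, abs_zero]) continuousOn_const ht x
  simpa using h0

/-- **Cross-derivative envelope for a shear-type coupling.** If `∂ᵢu ≡ 0` on `[a, b]`, `|∂ᵢθ(a, ·)| ≤ Mᵢ`,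
`|∂ⱼθ(a, ·)| ≤ Mⱼ`, and the coupling of the `j`-derivative of the drift to the gradient only sees `∂ᵢθ`,
`|⟪∂ⱼu(s, x), ∇θ(s, x)⟫| ≤ A(s)·|∂ᵢθ(s, x)|` with `A ≥ 0` continuous (for a shear `u = r(t)U(xⱼ)eᵢ`:
`A = |r|·sup|U′|`), then `|∂ⱼθ(t, x)| ≤ Mⱼ + Mᵢ ∫ₐᵗ A` on `[a, b]` — the per-pulse sup-gradient envelope with total
strain `∫|r|`. [cite: Evans2010, §7.1.4 Thms. 8–9 (maximum principle with source) with §7.1.3 Thm. 5] -/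
theorem abs_partialDeriv_le_add_mul_integral_of_shear {S : Set ℝ} (h : IsClassicalScalarTransportOn S κ u θ)
    (hκ : 0 ≤ κ) {a b : ℝ} (hI : Icc a b ⊆ S) (i j : d) {Mi Mj : ℝ}
    (hMi : ∀ x, |FunctionSpaces.Torus.partialDeriv i (θ a) x| ≤ Mi)
    (hMj : ∀ x, |FunctionSpaces.Torus.partialDeriv j (θ a) x| ≤ Mj)
    (hu : ∀ t ∈ Icc a b, ∀ x, FunctionSpaces.Torus.partialDeriv i (u t) x = 0) {A : ℝ → ℝ}
    (hA : ∀ t ∈ Icc a b, ∀ x, |⟪FunctionSpaces.Torus.partialDeriv j (u t) x,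
      FunctionSpaces.Torus.gradient (θ t) x⟫_ℝ| ≤ A t * |FunctionSpaces.Torus.partialDeriv i (θ t) x|)
    (hA0 : ∀ t ∈ Icc a b, 0 ≤ A t) (hAc : ContinuousOn A (Icc a b)) {t : ℝ} (ht : t ∈ Icc a b)
    (x : UnitAddTorus d) :
    |FunctionSpaces.Torus.partialDeriv j (θ t) x| ≤ Mj + Mi * ∫ s in a..t, A s := by
  have hi : ∀ s ∈ Icc a b, ∀ y, |FunctionSpaces.Torus.partialDeriv i (θ s) y| ≤ Mi :=
    fun s hs y => h.abs_partialDeriv_le_of_partialDeriv_velocity_eq_zero hκ hI i hMi hu hs y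
  have hF : ∀ s ∈ Icc a b, ∀ y, |⟪FunctionSpaces.Torus.partialDeriv j (u s) y,
      FunctionSpaces.Torus.gradient (θ s) y⟫_ℝ| ≤ A s * Mi :=
    fun s hs y => (hA s hs y).trans (mul_le_mul_of_nonneg_left (hi s hs y) (hA0 s hs))
  have h1 := h.abs_partialDeriv_le_add_integral hκ hI j hMj hF (hAc.mul continuousOn_const) ht x
  have h2 : ∫ s in a..t, A s * Mi = Mi * ∫ s in a..t, A s := by
    rw [intervalIntegral.integral_mul_const]; ring
  linarith [h2]

end IsClassicalScalarTransportOn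

end Torus

end Literature.Analysis.FluidPDE

end
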